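import Summits.Ventures.QEC.Census.GB.GB46_PK21q
import Summits.Ventures.QEC.Census.BB.BBRows
import Summits.Ventures.QEC.Census.BB.Claims
import Literature.InformationTheory.QuantumCodes.GeneralizedBicycleCodesPK21
import Literature.InformationTheory.QuantumCodes.CSSParameters
import HarnessLib

/-!
# Panteleev–Kalachev Table-1 row A4 `[[46, 2, 9]]` holds for the TYPED object `BB.pk21A4` (tier KERNEL, distance EXACT)

`BB.pk21A4 : BB.Code 24 1` is the generalized-bicycle code `GB(a, b)`, `ℓ = 23`, `a(x) = 1 + x⁵ + x⁸ + x¹²`,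
`b(x) = 1 + x + x⁵ + x⁷` of [PanteleevKalachev2021, App. B] typed in
`Literature/InformationTheory/QuantumCodes/GeneralizedBicycleCodesPK21.lean` (printed row: Table 1 A4, `[[46,2,9]]`, `w = 8`; PK21q Example 3).
The census certified the SAME matrices as the explicit code of row `GB46_PK21q` (`Census/GB/GB46_PK21q.lean`, qec-search-3 g8 orbit lane,
p564334: `GB46_PK21q.isCode : (cert.code _).IsCode 46 2 9`, orbit-averaged information-set certificate, KERNEL-std; kernel B certB f734b3af3be721cc, job j258249).
This file reads that row as a statement about the typed construction, by qec-type-05's bridge pattern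
(`Census/BB/BBRowsQC01.lean` …): monomial lists `la`, `lb`; `BB.pk21A4.A = polyL la`, `.B = polyL lb` (unfolding `BB.xPow`); the kernel
INDEX IDENTITIES `GB46_PK21q.cert.HX = BBRows.rowsX la lb`, `… .HZ = rowsZ la lb` (`decide +kernel` — the census generator file
`census/search-3/gens/c3/GB46_PK21q.json` uses the convention of Bravyi et al. §4 = `BivariateBicycleCodes.lean`, `L` block = qubits
`0…22`, `R` block = `23…45`, row `i` of `x^e` ↦ column `i + e`; checked row-for-row in Python before filing); the flat identities via
`BBRows.rowMatrix_rowsX/Z`; transport of the row's `dZ_eq` and `k_eq` by `BB.Code.dZ_eq_of_flat` / `k_eq_of_flat`; assembled as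
**`PK21A4_2_9_holds : BB.HasParams BB.pk21A4 46 2 9`** (`Census/BB/Claims.lean` census predicate, distance EXACT = printed `9`) and
`isCode : BB.pk21A4.css.IsCode 46 2 9`.

No new certificate — tier KERNEL, axioms standard, no `native_decide`. HONEST FRAMING: a REPRODUCTION of the printed parameters
`[[46,2,9]]` on the typed object (the printed value was obtained by MILP/GLPK, PK21q App. B p0020); ours is an independent machine-checked
certificate chain (kernel-A orbit certificate replayed in the Lean kernel + this transport); no novelty word. Companion of qec-search-2 g4's
`PK21A5UB` / `PK21A1UB` / `PK21A6UB` (upper-bound rows of the open-in-print PK21 codes). qec-search-2 g5.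
-/

namespace Summit.Ventures.QEC.Census.PK21A4

open Matrix Literature.InformationTheory.QuantumCodes BBRows

/-- Monomials of `BB.pk21A4.A = 1 + x⁵ + x⁸ + x¹²` on `ℤ₂₃ × ℤ₁`. DATA. -/
def la : List (BB.Mono 23 1) := [(Fin.ofNat 23 0, 0), (Fin.ofNat 23 5, 0), (Fin.ofNat 23 8, 0), (Fin.ofNat 23 12, 0)]

/-- Monomials of `BB.pk21A4.B = 1 + x + x⁵ + x⁷` on `ℤ₂₃ × ℤ₁`. DATA. -/
def lb : List (BB.Mono 23 1) := [(Fin.ofNat 23 0, 0), (Fin.ofNat 23 1, 0), (Fin.ofNat 23 5, 0), (Fin.ofNat 23 7, 0)]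

/-- `BB.pk21A4.A = polyL la` (unfolding `BB.xPow`). -/
theorem obj_A : BB.pk21A4.A = polyL la := by
  simp only [BB.pk21A4, polyL, la, List.map, List.sum_cons, List.sum_nil, add_zero, BB.xPow, add_assoc]

/-- `BB.pk21A4.B = polyL lb`. -/
theorem obj_B : BB.pk21A4.B = polyL lb := by
  simp only [BB.pk21A4, polyL, lb, List.map, List.sum_cons, List.sum_nil, add_zero, BB.xPow, add_assoc]

set_option maxRecDepth 100000 in
/-- INDEX IDENTITY, `X` side, in the kernel: the census certificate's `H^X` rows ARE the `X`-check words of `BB.pk21A4`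
(`decide +kernel`). -/
theorem HX_eq_rowsX : GB46_PK21q.cert.HX = rowsX la lb := by
  decide +kernel

set_option maxRecDepth 100000 in
/-- INDEX IDENTITY, `Z` side. -/
theorem HZ_eq_rowsZ : GB46_PK21q.cert.HZ = rowsZ la lb := by
  decide +kernel

set_option maxRecDepth 100000 in
/-- The certificate's flat `H^X` is `BB.pk21A4.HXFlat`. -/
theorem rowMatrix_HX_eq : rowMatrix 46 GB46_PK21q.cert.HX = BB.pk21A4.HXFlat := by
  have cast : ∀ {H H' : List ℕ} (e : H = H'),
      rowMatrix 46 H = (rowMatrix 46 H').submatrix (Fin.cast (congrArg List.length e)) id := by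
    intro H H' e; subst e; rfl
  exact (cast HX_eq_rowsX).trans (rowMatrix_rowsX BB.pk21A4 (LA := la) (LB := lb) obj_A obj_B)

set_option maxRecDepth 100000 in
/-- The certificate's flat `H^Z` is `BB.pk21A4.HZFlat`. -/
theorem rowMatrix_HZ_eq : rowMatrix 46 GB46_PK21q.cert.HZ = BB.pk21A4.HZFlat := by
  have cast : ∀ {H H' : List ℕ} (e : H = H'),
      rowMatrix 46 H = (rowMatrix 46 H').submatrix (Fin.cast (congrArg List.length e)) id := by
    intro H H' e; subst e; rfl
  exact (cast HZ_eq_rowsZ).trans (rowMatrix_rowsZ BB.pk21A4 (LA := la) (LB := lb) obj_A obj_B)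

set_option maxRecDepth 100000 in
/-- `d^Z (BB.pk21A4) = 9`, transported from the census certificate (`GB46_PK21q.dZ_eq`) by `BB.Code.dZ_eq_of_flat`. -/
theorem obj_dZ : BB.pk21A4.css.dZ = 9 :=
  (BB.pk21A4.dZ_eq_of_flat (D := GB46_PK21q.cert.code (GB46_PK21q.cert.commOK_of_checkStructure GB46_PK21q.checkStructure_ok))
    rowMatrix_HX_eq rowMatrix_HZ_eq).symm.trans GB46_PK21q.dZ_eq

set_option maxRecDepth 100000 in
/-- `k (BB.pk21A4) = 2`, transported from the census certificate (`GB46_PK21q.k_eq`) by `BB.Code.k_eq_of_flat`. -/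
theorem obj_k : BB.pk21A4.k = 2 :=
  (BB.pk21A4.k_eq_of_flat (D := GB46_PK21q.cert.code (GB46_PK21q.cert.commOK_of_checkStructure GB46_PK21q.checkStructure_ok))
    rowMatrix_HX_eq rowMatrix_HZ_eq).symm.trans GB46_PK21q.k_eq

/-- **Panteleev–Kalachev Table 1 row A4: `GB(1 + x⁵ + x⁸ + x¹², 1 + x + x⁵ + x⁷)`, `ℓ = 23`, has parameters `[[46, 2, 9]]`**
(distance EXACT; `BB.HasParams`, the census predicate of `Census/BB/Claims.lean`) — the printed row REPRODUCED on the typed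
object `BB.pk21A4`. KERNEL. -/
theorem PK21A4_2_9_holds : Summit.Ventures.QEC.BB.HasParams BB.pk21A4 46 2 9 :=
  BB.hasParams_of_dZ (by simp only [BB.numQubits_eq]) obj_k obj_dZ

/-- The same in the generic census vocabulary: `BB.pk21A4.css.IsCode 46 2 9`. -/
theorem isCode : BB.pk21A4.css.IsCode 46 2 9 :=
  (BB.hasParams_iff_isCode (by decide)).1 PK21A4_2_9_holds

/-- Both one-sided distances of `BB.pk21A4` equal `9`. -/
theorem obj_dX_dZ : BB.pk21A4.css.dX = 9 ∧ BB.pk21A4.css.dZ = 9 :=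
  BB.dX_eq_of_hasParams PK21A4_2_9_holds

end Summit.Ventures.QEC.Census.PK21A4
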